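import Mathlib
import HarnessLib

/-!
# DHL[42,2] certificate — `U_t(u)`, the mass of the coordinates of `t` at least `u` (Section 1.4)

`bigU t u = U_t(u) = Σ_{j : t_j ≥ u} t_j` for a point `t ∈ ℝⁿ` and a level `u` (paper, Section 1.4
Notation), and its antitonicity in the level on `[0,∞)^n` (`bigU_antitone`). Kept apart from the §7
data (`Dhl42DefsRegions`) because the general combinatorics of Sections 3–5 (`Dhl42ChainCondC`,
`Dhl42Staircase`, `Dhl42BridgeH2`: `bigU_eq_Usum`, the pair condition, the staircase regions of
Definition 5.2) use `U_t` and nothing else of Part 5. NOT here: `bigU_sentinel` and every fact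
involving the level tables (→ `Dhl42DefsRegions`).

Origin: the verbatim leg `Dhl42/TpY4Dhl42.lean` of the DHL[42,2] certificate package (pub-dhl42
bundle, archive blob `18cce9e3`; paper snapshot = `paper/main.tex` v1), lines :824–:827, :832–:842;
statements and proofs unchanged except: namespace `TpY4Dhl42` →
`Summit.Parity.GeneralizedHardyLittlewood.Theorems.Dhl42`, the package's `simplexSet n B` replaced
by the tree's definitionally equal `Literature.NumberTheory.Sieve.scaledSimplex n B`
(`PolymathBoundedGaps.lean`), docstrings added where missing.

Declarations (2): `bigU`, `bigU_antitone`.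
-/

namespace Summit.Parity.GeneralizedHardyLittlewood.Theorems.Dhl42

noncomputable section

open scoped Classical in
/-- `U_t(u) = Σ_{j : t_j ≥ u} t_j`, the mass of the coordinates of `t` that
are at least `u` (paper, Section 1.4). -/
def bigU {n : ℕ} (t : Fin n → ℝ) (u : ℝ) : ℝ := ∑ j, if u ≤ t j then t j else 0

/-- `U_t` is antitone in the level (on non-negative coordinates): raising the
level can only drop terms. -/
theorem bigU_antitone {n : ℕ} {t : Fin n → ℝ} (ht : ∀ j, 0 ≤ t j) {u u' : ℝ}
    (h : u ≤ u') : bigU t u' ≤ bigU t u := by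
  unfold bigU
  refine Finset.sum_le_sum fun j _ => ?_
  by_cases hj : u' ≤ t j
  · rw [if_pos hj, if_pos (le_trans h hj)]
  · rw [if_neg hj]
    by_cases hj' : u ≤ t j
    · rw [if_pos hj']; exact ht j
    · rw [if_neg hj']

end

end Summit.Parity.GeneralizedHardyLittlewood.Theorems.Dhl42
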